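import Summits.BirchSwinnertonDyer.BirchSwinnertonDyer.Theorems.SchneiderFreeAdditiveX3GordCellThreePerPair
import Summits.BirchSwinnertonDyer.BirchSwinnertonDyer.Theorems.EisensteinPrimesResidualCharacterSelmerFiniteOfFact
import HarnessLib

/-!
# Route `SchneiderFreeAdditiveX3` (K1 door) on the (G-ord, `e = 2`) cell AT `p = 3`, PER PAIR, non-anomalous twists: the crux currency
# `AdditiveIMCLowerBDPInputManinAt W 3`, the lower half, `MissingPPartAt W 3` and Miller's `BSD(E, 3)` on EIGHT published named facts —
# CGLS 2022 Prop. 1.2.5's FINITENESS clause (arXiv Prop. 14, `prop14_residualCharacterSelmer_finite`) is SUPPLIED from its MODULE clause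
# (`prop125_characterGrSelmerDual_torsion_muZero_dim`) by cell `bsd-eis`'s tree theorem `prop14_residualCharacterSelmer_finite_of_fact`

Cell `bsd-schneider-ideate`, seat `bsd-schneider-door-c5` (prover, generation 28; assembly layer; `--supports` 19177).
PARTITION: board row B6 ∩ X3 ∩ sst-twist, `r = 1`, (G-ord, `e = 2`) half at `p = 3` (2 411 pairs; the 686 NON-ANOMALOUS ones) of
`Rank1Residual.partition` — PER-PAIR ASSEMBLY on top of generation 27's `…GordCellThreePerPair` §4 (ten facts); types-the-object-of nothing; closes
none of B6's cells (BSD NOT advanced).  bears_on: K1-door (19177 r3).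

WHY.  Generation 27's end state (`additiveIMCLowerBDPInputManinAt_gordTwo_three_of_print_of_forall_twist_tenFacts`,
`bsdp_gordTwo_three_of_printedFacts_of_print_of_twistUnitAt_of_forall_twist_tenFacts`) carries BOTH named facts typed from the one printed
proposition CGLS 2022 Prop. 1.2.5 (= arXiv:2008.02571 Prop. 14): its module-and-dimension clause `prop125_characterGrSelmerDual_torsion_muZero_dim`
(`hprop125`) and its finiteness clause `prop14_residualCharacterSelmer_finite` (`hfact`).  Cell `bsd-eis` (width seat `bsd-line-x2-p2` gen 9, file
`Theorems/EisensteinPrimesResidualCharacterSelmerFiniteOfFact.lean`) PROVED the finiteness clause from the module clause in the kernel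
(`TeichmullerPairUnramifiedAtMult.prop14_residualCharacterSelmer_finite_of_fact`: the Teichmüller lift of the character of `M` is constructed, `M ↪
(F/𝒪)(θ)[p]`, Kummer injectivity + Pontryagin).  Supplying it here removes one name from the door's ledger: the crux currency and the lower half per
NON-ANOMALOUS pair at `p = 3` rest on {Kolyvagin, modularity, Hsieh 2014 Thm. A, Liu–Zhang–Zhang 2018, Castella–Hsieh signed} ∪ {[DIV.dvd] PREPRINT,
[AN3] PUB-composed (audit pending), [BR3] PUB} ∪ EIGHT published named facts (CGLS 2022 Thm. 2.1.2, Prop. 1.2.5 (module clause), Cor. 1.2.6 ×2;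
Greenberg 2016 Props. 4.1.1, 2.6.3; Greenberg 2006 Props. 4.1, 3.2); `BSD(E, 3)` per pair additionally on the pair's twist-unit certificate.

WHAT.
* §1 **`additiveIMCLowerBDPInputManinAt_gordTwo_three_of_print_of_forall_twist_eightFacts`** — crux r3's OWN conclusion at `p = 3` on the NAT pairs of
  the cell, generation 27's `_tenFacts` with `hfact := prop14_residualCharacterSelmer_finite_of_fact hprop125`.
* §2 **`missingLowerBoundAt_gordTwo_three_of_printedFacts_of_print_of_forall_twist_eightFacts`**, **`missingPPartAt_gordTwo_three_…_eightFacts`**,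
  **`bsdp_gordTwo_three_…_eightFacts`** — the lower half, `MissingPPartAt W 3` and Miller's `BSD(E, 3)` per NAT pair likewise (the upper half's own
  `prop14` input, generation 25, is fed the same derived term).

HONEST FRAMING: THEOREMS ONLY; pure composition of tree theorems, CONDITIONAL on the displayed hypotheses; [DIV.dvd] is an unrefereed PREPRINT
sentence, [AN3] a PUB-composed typed statement whose audit is pending; nothing is closed by me; BSD is proved for no curve — per pair this is BSD₃
MODULO {published theorems} ∪ {[DIV.dvd], [AN3]} ∪ {the pair's twist-unit certificate}.  No definition, no `sorry`, no new named fact.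

References: [CastellaGrossiLeeSkinner2022] Invent. Math. 227 (2022) §1.2 Prop. 1.2.5 (module / dimension / finiteness clauses), Lemma 1.2.4,
Cor. 1.2.6, Thm. 2.1.2; [Greenberg2016] Props. 2.6.3, 4.1.1; [Greenberg2006] Props. 3.2, 4.1 (4.2 and §5 A are tree theorems); [KellerYin2024b]
arXiv:2410.23241 Thm. 3.3.6 ∘ Prop. 3.4.4 ([DIV.dvd], preprint); [Miller2011LMS] Def. 1.1; cell files p684792/p685014/p685637 (generation 27),
bsd-eis `EisensteinPrimesResidualCharacterSelmerFiniteOfFact`.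
-/

set_option autoImplicit false
-- `Summit.<P>.<Sub>` repeats `BirchSwinnertonDyer` by the tree's layout convention (D-0017)
set_option linter.dupNamespace false

noncomputable section

open scoped Classical NumberField

open Field NumberField IsDedekindDomain WeierstrassCurve
  Literature.NumberTheory.EllipticCurves Literature.NumberTheory.EllipticCurves.GreenbergSelmer
  Literature.NumberTheory.GaloisRepresentations Literature.NumberTheory.GaloisCohomology
  Literature.NumberTheory.EllipticCurves.ModularForms Literature.NumberTheory.EllipticCurves.Rank1Residual
  Literature.NumberTheory.EllipticCurves.Rank1Residual.Typed
  Literature.NumberTheory.EllipticCurves.KellerYin2024 Literature.NumberTheory.EllipticCurves.CaiShuTian2014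
  Literature.NumberTheory.IwasawaTheory Literature.NumberTheory.IwasawaTheory.Greenberg2016
  Literature.NumberTheory.IwasawaTheory.Greenberg2006
  Summit.BirchSwinnertonDyer.Rank1Residual Summit.BirchSwinnertonDyer.Rank1Residual.X11b
  Summit.BirchSwinnertonDyer.Rank1Residual.X11b.AcSelmer Summit.BirchSwinnertonDyer.Rank1Residual.X11b.Halves
  Summit.BirchSwinnertonDyer.BirchSwinnertonDyer.Theorems.SchneiderFree
  Summit.BirchSwinnertonDyer.BirchSwinnertonDyer.Theorems.SchneiderFree.Upper
  Summit.BirchSwinnertonDyer.BirchSwinnertonDyer.Theorems.SchneiderFree.KYRead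
  Summit.BirchSwinnertonDyer.BirchSwinnertonDyer.Theses.SchneiderFreeAdditiveX3
  Summit.BirchSwinnertonDyer.BirchSwinnertonDyer.Theorems.SchneiderFreeAdditiveX3.ControlDischarged
  Summit.BirchSwinnertonDyer.BirchSwinnertonDyer.Theorems.SchneiderFreeAdditiveX3.KYBranchOnly
  Summit.BirchSwinnertonDyer.BirchSwinnertonDyer.Theorems.SchneiderFreeAdditiveX3.KYBranchThreeAux
  Summit.BirchSwinnertonDyer.BirchSwinnertonDyer.Theorems.SchneiderFreeAdditiveX3.KYBranchThreePerPair
  Summit.BirchSwinnertonDyer.BirchSwinnertonDyer.Theorems.SchneiderFreeAdditiveX3.UpperOfPrintNonAnomalousTwist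
open Literature.NumberTheory.EllipticCurves.CastellaGrossiLeeSkinner2022
  (cor126_residualCharacter_globalLift cor126_residualCharacter_localSurjective
    prop125_characterGrSelmerDual_torsion_muZero_dim prop14_residualCharacterSelmer_finite thm212_exists_isKatzLFunction)
open Summit.BirchSwinnertonDyer.BirchSwinnertonDyer.Theorems.TeichmullerPairUnramifiedAtMult (prop14_residualCharacterSelmer_finite_of_fact)

namespace Summit.BirchSwinnertonDyer.BirchSwinnertonDyer.Theorems.SchneiderFreeAdditiveX3.KYBranchThreePerPairEight

/-! ### §1 Crux r3's own currency at `p = 3` on the NAT pairs — EIGHT published named facts -/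

/-- **Crux r3's conclusion `AdditiveIMCLowerBDPInputManinAt W 3` on the non-anomalous pairs of the (G-ord, `e = 2`) cell, on EIGHT published
named facts**: ⟸ Kolyvagin ∧ modularity (a parametrisation datum) ∧ Hsieh 2014 Thm. A ∧ Liu–Zhang–Zhang 2018 ∧ Castella–Hsieh signed ∧ [DIV.dvd]
(PREPRINT) ∧ [AN3] (PUB-composed) ∧ [BR3] (PUB) ∧ {CGLS 2022 Thm. 2.1.2, Prop. 1.2.5 (module clause), Cor. 1.2.6 ×2; Greenberg 2016 Props. 4.1.1,
2.6.3; Greenberg 2006 Props. 4.1, 3.2}.  Generation 27's `_tenFacts` (Greenberg 2006 Prop. 4.2 / §5 A already supplied there) with CGLS Prop. 1.2.5's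
finiteness clause `hfact` SUPPLIED as `prop14_residualCharacterSelmer_finite_of_fact hprop125` (cell `bsd-eis`'s tree theorem).  CONDITIONAL on the
displayed hypotheses; the crux (all odd `p`, all pairs) stays OPEN; BSD not advanced. [claim: KellerYin2024PotOrd, status: under-review]
[cite: CastellaGrossiLeeSkinner2022, §1.2 Prop. 1.2.5 with Lemma 1.2.4 (arXiv:2008.02571 Prop. 14; Invent. Math. 227 (2022)), Cor. 1.2.6, Thm. 2.1.2]
[cite: KellerYin2024b, Thm. 3.3.6, Prop. 3.4.4 (arXiv:2410.23241 p. 19) (preprint; hypothesis)]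
[cite: Greenberg2006, Props. 3.2, 4.1 (pp. 358, 367)] [cite: Greenberg2016, Props. 2.6.3, 4.1.1] -/
theorem additiveIMCLowerBDPInputManinAt_gordTwo_three_of_print_of_forall_twist_eightFacts
    (hKo : ∀ (N : ℕ) [NeZero N] (W : WeierstrassCurve ℚ) (K : Type) [Field K] [NumberField K],
      Literature.NumberTheory.EllipticCurves.kolyvagin N W K)
    (hPar : nonempty_modularParametrizationData)
    (hA : Hsieh2014.thmA_exists_isHsiehLFunction_unrPeriod_anyLevel)
    (hL : LiuZhangZhang2018.thm151_thm153_modularCurve_heegnerVector_additive)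
    (hCHσ : castellaHsieh2018_exists_isBranchBDPLFunction_signed)
    (hDVD : thm336_dvd_branch_OPEN) (hAN : thm351_anacong_branch_three) (hBR : thm122_charLambda_pair_three)
    (h212 : thm212_exists_isKatzLFunction)
    (hprop125 : prop125_characterGrSelmerDual_torsion_muZero_dim)
    (hlift : cor126_residualCharacter_globalLift) (hlocal : cor126_residualCharacter_localSurjective)
    (h411 : prop411_selmer_isAlmostDivisible) (h263 : prop263_sur_of_crk) (h41 : prop41_globalEulerPoincareCorank)
    (h32 : prop32_cohomology_isCofinitelyGenerated) :
    ∀ (W : WeierstrassCurve ℚ) [W.IsElliptic] [W.IsGloballyMinimal],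
      W.analyticRank = 1 → ClassX3 W 3 → Additive.SubGordTwo W 3 →
      (∀ (V : WeierstrassCurve ℚ) [V.IsElliptic] [V.IsGloballyMinimal] (C : VariableChange ℚ),
        GoodOrd V 3 → C • V.quadraticTwist ((-1 : ℚ) ^ (3 / 2) * (3 : ℕ)) = W → ¬ (3 : ℤ) ∣ V.frobeniusTrace 3 - 1) →
      AdditiveIMCLowerBDPInputManinAt W 3 :=
  KYBranchThreePerPair.additiveIMCLowerBDPInputManinAt_gordTwo_three_of_print_of_forall_twist_tenFacts hKo hPar hA hL hCHσ hDVD hAN hBR h212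
    hprop125 (prop14_residualCharacterSelmer_finite_of_fact hprop125) hlift hlocal h411 h263 h41 h32

/-! ### §2 The lower half, `MissingPPartAt W 3` and Miller's `BSD(E, 3)` per NAT pair — EIGHT published named facts -/

/-- **LOWER half per pair (`MissingLowerBoundAt W 3`: `ord₃ #Ш(E)_an ≤ ord₃ #Ш(E)`) on the (G-ord, `e = 2`) cell at `p = 3`, non-anomalous twists, on
EIGHT published named facts** (∪ `PrintedFacts` ∪ Hsieh A ∪ LZZ ∪ Castella–Hsieh signed ∪ {[DIV.dvd], [AN3], [BR3]}): generation 27's §1 with Greenberg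
2006 Prop. 4.2 / §5 A supplied by the tree's theorems and CGLS Prop. 1.2.5's finiteness clause supplied from its module clause.  CONDITIONAL; closes
no item; BSD not advanced beyond this typed reduction. [claim: KellerYin2024PotOrd, status: under-review]
[cite: CastellaGrossiLeeSkinner2022, §1.2 Prop. 1.2.5 with Lemma 1.2.4, Cor. 1.2.6, Thm. 2.1.2]
[cite: Greenberg2006, §4 A Prop. 4.2 (p. 368) and §5 A (pp. 372–373) (tree theorems), Props. 3.2, 4.1]
[cite: KellerYin2024b, Thm. 3.3.6, Prop. 3.4.4 (arXiv:2410.23241 p. 19) (preprint; hypothesis)] -/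
theorem missingLowerBoundAt_gordTwo_three_of_printedFacts_of_print_of_forall_twist_eightFacts (hF : PrintedFacts)
    (hA : Hsieh2014.thmA_exists_isHsiehLFunction_unrPeriod_anyLevel)
    (hL : LiuZhangZhang2018.thm151_thm153_modularCurve_heegnerVector_additive)
    (hCHσ : castellaHsieh2018_exists_isBranchBDPLFunction_signed)
    (hDVD : thm336_dvd_branch_OPEN) (hAN : thm351_anacong_branch_three) (hBR : thm122_charLambda_pair_three)
    (h212 : thm212_exists_isKatzLFunction)
    (hprop125 : prop125_characterGrSelmerDual_torsion_muZero_dim)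
    (hlift : cor126_residualCharacter_globalLift) (hlocal : cor126_residualCharacter_localSurjective)
    (h411 : prop411_selmer_isAlmostDivisible) (h263 : prop263_sur_of_crk) (h41 : prop41_globalEulerPoincareCorank)
    (h32 : prop32_cohomology_isCofinitelyGenerated) :
    ∀ (W : WeierstrassCurve ℚ) [W.IsElliptic] [W.IsGloballyMinimal],
      W.analyticRank = 1 → ClassX3 W 3 → Additive.SubGordTwo W 3 →
      (∀ (V : WeierstrassCurve ℚ) [V.IsElliptic] [V.IsGloballyMinimal] (C : VariableChange ℚ),
        GoodOrd V 3 → C • V.quadraticTwist ((-1 : ℚ) ^ (3 / 2) * (3 : ℕ)) = W → ¬ (3 : ℤ) ∣ V.frobeniusTrace 3 - 1) →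
      MissingLowerBoundAt W 3 :=
  KYBranchThreePerPair.missingLowerBoundAt_gordTwo_three_of_printedFacts_of_print_of_forall_twist hF hA hL hCHσ hDVD hAN hBR h212 hprop125
    (prop14_residualCharacterSelmer_finite_of_fact hprop125) hlift hlocal h411 h263 h41 Greenberg2006.prop42_localEulerPoincareCorank_holds
    Greenberg2006.sec5A_localH2_subsingleton_of_LOC1_holds h32

/-- **`MissingPPartAt W 3` (`ord₃ #Ш(E)_an = ord₃ #Ш(E)`) per pair on the (G-ord, `e = 2`) cell, non-anomalous twists, with the pair's twist-unit
datum, on EIGHT published named facts** (∪ `PrintedFacts` ∪ Hsieh A ∪ LZZ ∪ Castella–Hsieh signed ∪ {[DIV.dvd], [AN3], [BR3]} ∪ {TU}): generation 27's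
§2 with Greenberg 2006 Prop. 4.2 / §5 A supplied by the tree's theorems and CGLS Prop. 1.2.5's finiteness clause — used by BOTH halves — supplied
from its module clause.  CONDITIONAL; closes no item; BSD not advanced. [claim: KellerYin2024PotOrd, status: under-review]
[cite: CastellaGrossiLeeSkinner2022, §1.2 Prop. 1.2.5 with Lemma 1.2.4, Cor. 1.2.6, Thm. 2.1.2] [cite: Greenberg2006, Props. 3.2, 4.1, 4.2, §5 A]
[cite: KellerYin2024b, Thm. 3.3.6, Prop. 3.4.4 (arXiv:2410.23241 p. 19) (preprint; hypothesis)] -/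
theorem missingPPartAt_gordTwo_three_of_printedFacts_of_print_of_twistUnitAt_of_forall_twist_eightFacts (hF : PrintedFacts)
    (hA : Hsieh2014.thmA_exists_isHsiehLFunction_unrPeriod_anyLevel)
    (hL : LiuZhangZhang2018.thm151_thm153_modularCurve_heegnerVector_additive)
    (hCHσ : castellaHsieh2018_exists_isBranchBDPLFunction_signed)
    (hDVD : thm336_dvd_branch_OPEN) (hAN : thm351_anacong_branch_three) (hBR : thm122_charLambda_pair_three)
    (h212 : thm212_exists_isKatzLFunction)
    (hprop125 : prop125_characterGrSelmerDual_torsion_muZero_dim)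
    (hlift : cor126_residualCharacter_globalLift) (hlocal : cor126_residualCharacter_localSurjective)
    (h411 : prop411_selmer_isAlmostDivisible) (h263 : prop263_sur_of_crk) (h41 : prop41_globalEulerPoincareCorank)
    (h32 : prop32_cohomology_isCofinitelyGenerated) :
    ∀ (W : WeierstrassCurve ℚ) [W.IsElliptic] [W.IsGloballyMinimal],
      W.analyticRank = 1 → ClassX3 W 3 → Additive.SubGordTwo W 3 →
      (∀ (V : WeierstrassCurve ℚ) [V.IsElliptic] [V.IsGloballyMinimal] (C : VariableChange ℚ),
        GoodOrd V 3 → C • V.quadraticTwist ((-1 : ℚ) ^ (3 / 2) * (3 : ℕ)) = W → ¬ (3 : ℤ) ∣ V.frobeniusTrace 3 - 1) →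
      Upper.TwistUnitFieldOffSliverAt W 3 → MissingPPartAt W 3 :=
  KYBranchThreePerPair.missingPPartAt_gordTwo_three_of_printedFacts_of_print_of_twistUnitAt_of_forall_twist hF hA hL hCHσ hDVD hAN hBR h212
    hprop125 (prop14_residualCharacterSelmer_finite_of_fact hprop125) hlift hlocal h411 h263 h41 Greenberg2006.prop42_localEulerPoincareCorank_holds
    Greenberg2006.sec5A_localH2_subsingleton_of_LOC1_holds h32

/-- **Miller's `BSD(E, 3)` per pair on the (G-ord, `e = 2`) cell, non-anomalous twists, with the pair's twist-unit datum, on EIGHT published named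
facts** (∪ `PrintedFacts` ∪ Hsieh A ∪ LZZ ∪ Castella–Hsieh signed ∪ {[DIV.dvd], [AN3], [BR3]} ∪ {TU}): generation 27's `_tenFacts` with CGLS Prop. 1.2.5's
finiteness clause supplied from its module clause.  NOT a proof of BSD for any curve (modulo the displayed hypotheses); closes no item.
[claim: KellerYin2024PotOrd, status: under-review] [cite: Miller2011LMS, §1 and Def. 1.1]
[cite: CastellaGrossiLeeSkinner2022, §1.2 Prop. 1.2.5 with Lemma 1.2.4, Cor. 1.2.6, Thm. 2.1.2] [cite: Greenberg2006, Props. 3.2, 4.1]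
[cite: KellerYin2024b, Thm. 3.3.6, Prop. 3.4.4 (arXiv:2410.23241 p. 19) (preprint; hypothesis)] -/
theorem bsdp_gordTwo_three_of_printedFacts_of_print_of_twistUnitAt_of_forall_twist_eightFacts (hF : PrintedFacts)
    (hA : Hsieh2014.thmA_exists_isHsiehLFunction_unrPeriod_anyLevel)
    (hL : LiuZhangZhang2018.thm151_thm153_modularCurve_heegnerVector_additive)
    (hCHσ : castellaHsieh2018_exists_isBranchBDPLFunction_signed)
    (hDVD : thm336_dvd_branch_OPEN) (hAN : thm351_anacong_branch_three) (hBR : thm122_charLambda_pair_three)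
    (h212 : thm212_exists_isKatzLFunction)
    (hprop125 : prop125_characterGrSelmerDual_torsion_muZero_dim)
    (hlift : cor126_residualCharacter_globalLift) (hlocal : cor126_residualCharacter_localSurjective)
    (h411 : prop411_selmer_isAlmostDivisible) (h263 : prop263_sur_of_crk) (h41 : prop41_globalEulerPoincareCorank)
    (h32 : prop32_cohomology_isCofinitelyGenerated) :
    ∀ (W : WeierstrassCurve ℚ) [W.IsElliptic] [W.IsGloballyMinimal],
      W.analyticRank = 1 → ClassX3 W 3 → Additive.SubGordTwo W 3 →
      (∀ (V : WeierstrassCurve ℚ) [V.IsElliptic] [V.IsGloballyMinimal] (C : VariableChange ℚ),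
        GoodOrd V 3 → C • V.quadraticTwist ((-1 : ℚ) ^ (3 / 2) * (3 : ℕ)) = W → ¬ (3 : ℤ) ∣ V.frobeniusTrace 3 - 1) →
      Upper.TwistUnitFieldOffSliverAt W 3 → BSDp W 3 :=
  KYBranchThreePerPair.bsdp_gordTwo_three_of_printedFacts_of_print_of_twistUnitAt_of_forall_twist_tenFacts hF hA hL hCHσ hDVD hAN hBR h212
    hprop125 (prop14_residualCharacterSelmer_finite_of_fact hprop125) hlift hlocal h411 h263 h41 h32

end Summit.BirchSwinnertonDyer.BirchSwinnertonDyer.Theorems.SchneiderFreeAdditiveX3.KYBranchThreePerPairEight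

end
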